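import Summits.ResolutionOfSingularities.ResolutionOfSingularities.Theorems.FrobeniusClosingPatchingRelPerfectDepthSingletonTowerEnd
import Literature.AlgebraicGeometry.Resolution.RsopMonomialIdeals
import Literature.AlgebraicGeometry.Resolution.KollarBlowupSequenceFunctors
import HarnessLib

/-!
# Crux `PatchingRelPerfect` (stmt-ResolutionOfSingularities-16161), chain W5.2 — TargetsF4 support:
# REGULAR DIVISOR ⇔ LOCALLY PRINCIPAL OF ORDER `≤ 1` (the E-side terminal condition, both readings)

[OURS · L1 W5.2 · rung tool] TargetsF4 (res-L1-w52-plan-1 g7, `…DepthGradedTargets.lean`) states every E-side terminal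
condition in ORDER form — `PureResolvable ℓ 𝔟 := … ∧ IsLocallyPrincipal 𝔟′ ∧ ∀ e, idealOrder 𝔟′ e ≤ 1`, the smooth-form
member's `hord`, the cone target's `hreg` — while producers naturally know REGULARITY of a zero scheme (`V₊(P₀) ⊂ ℙ^m`
regular; the strict transform of a cone is a line bundle over a regular hypersurface). This file gives the converse of
`isRegular_subscheme_of_isLocallyPrincipal_of_idealOrder_le_one` (`…DepthSingletonTowerEnd.lean`, p504881) and the
resulting equivalence:

* `not_mem_sq_of_isRegularLocalRing_quotient` — ring lemma: `R` regular local, `0 ≠ b ∈ 𝔪`, `R/(b)` regular ⇒ `b ∉ 𝔪²`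
  (Matsumura 14.2, Remark «(3) ⇒ (1)»: `(b)` is part of a regular system of parameters, tree
  `IsRsopPart.of_isRegularLocalRing_quotient` with the dimension count `dim R/(b) + 1 = dim R` for a non-zero-divisor);
* **`idealOrder_le_one_of_isRegular_subscheme`** — on a regular locally Noetherian scheme, a locally principal ideal sheaf
  with non-zero stalks whose zero scheme is REGULAR has order `≤ 1` everywhere; `…_of_ne_bot` — on an INTEGRAL scheme
  «non-zero stalks» is `𝔟 ≠ ⊥` (tree `stalkIdeal_ne_bot_of_ne_bot`);
* `isRegular_subscheme_iff_forall_idealOrder_le_one` — the equivalence (locally principal, non-zero stalks).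

Fact-free; E-side generic. NOT a statement of the manuscript under review. AI-written; weaker than expert review.

## References (method; the statements are ours)
* H. Matsumura, *Commutative Ring Theory* (1986), Thm. 14.2 and the Remark following it. [Matsumura1987]
* E. Bierstone, D. Grigoriev, P. Milman, J. Włodarczyk, arXiv:1206.3090, §3.1 (order of an ideal at a point).
  [BierstoneGrigorievMilmanWlodarczyk2011]
-/

-- `Summit.<Summit>.<Sub>.Theorems` with `Sub = Summit` (single-conjunct summit, D-0017)
set_option linter.dupNamespace false

noncomputable section

open CategoryTheory CategoryTheory.Limits AlgebraicGeometry TopologicalSpace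
open Literature.AlgebraicGeometry.Resolution
open IsLocalRing

namespace Summit.ResolutionOfSingularities.ResolutionOfSingularities.Theorems.DepthTargets

universe u

/-! ## §1 The ring lemma -/

/-- **`R/(b)` regular with `b ≠ 0` forces `b ∉ 𝔪²`** in a regular local ring `R` (`b ∈ 𝔪`): `dim R/(b) + 1 = dim R`
(`b` a non-zero-divisor of the domain `R`), so `(b)` is part of a regular system of parameters (Matsumura 14.2, Remark),
whose members have order one. [cite: Matsumura1987, Thm. 14.2] -/
theorem not_mem_sq_of_isRegularLocalRing_quotient {R : Type*} [CommRing R] [IsRegularLocalRing R] {b : R}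
    (hb : b ∈ maximalIdeal R) (hb0 : b ≠ 0) (hreg : IsRegularLocalRing (R ⧸ Ideal.span {b})) :
    b ∉ maximalIdeal R ^ 2 := by
  haveI : IsDomain R := isDomain_of_isRegularLocalRing R
  have hz : Ideal.span (Set.range fun _ : Fin 1 => b) = Ideal.span {b} := by rw [Set.range_const]
  haveI : IsRegularLocalRing (R ⧸ Ideal.span (Set.range fun _ : Fin 1 => b)) := by rw [hz]; exact hreg
  have hdim : ringKrullDim (R ⧸ Ideal.span (Set.range fun _ : Fin 1 => b)) + (1 : ℕ) ≤ ringKrullDim R := by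
    rw [hz, Nat.cast_one]
    exact (ringKrullDim_quotient_span_singleton_succ_eq_ringKrullDim_of_mem_nonZeroDivisors
      (mem_nonZeroDivisors_of_ne_zero hb0) hb).le
  exact (IsRsopPart.of_isRegularLocalRing_quotient (z := fun _ : Fin 1 => b) (fun _ => hb) hdim).not_mem_sq 0

/-! ## §2 Regular zero scheme ⇒ order `≤ 1` -/

/-- **Regular zero scheme ⇒ order `≤ 1` everywhere** for a locally principal ideal sheaf with non-zero stalks on a
regular locally Noetherian scheme: at `e ∈ V(𝔟)`, `𝔟_e = (b)` with `b ≠ 0` and `𝒪_{E,e}/(b)` regular (tree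
`Scheme.isRegular_subscheme_iff`), so `b ∉ 𝔪_e²`; off `V(𝔟)` the order is `0`.
[cite: Matsumura1987, Thm. 14.2] [cite: BierstoneGrigorievMilmanWlodarczyk2011, §3.1 p. 6] -/
theorem idealOrder_le_one_of_isRegular_subscheme {E : Scheme.{u}} [IsLocallyNoetherian E] (hE : Scheme.IsRegular E)
    {𝔟 : E.IdealSheafData} (hlp : IsLocallyPrincipal 𝔟) (hnz : ∀ e : E, stalkIdeal 𝔟 e ≠ ⊥)
    (hreg : Scheme.IsRegular 𝔟.subscheme) (e : E) : idealOrder 𝔟 e ≤ 1 := by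
  by_cases he : e ∈ 𝔟.support
  · haveI := hE e
    obtain ⟨b, hb⟩ := exists_stalkIdeal_eq_span_of_isLocallyPrincipalAt (hlp e)
    have hbm : b ∈ maximalIdeal _ :=
      (mem_support_iff_stalkIdeal_le 𝔟 e).mp he (hb ▸ Ideal.mem_span_singleton_self b)
    have hb0 : b ≠ 0 := fun h => hnz e (by rw [hb, h, Ideal.span_singleton_eq_bot])
    have hq : IsRegularLocalRing (E.presheaf.stalk e ⧸ Ideal.span {b}) := by
      rw [← hb]; exact (Scheme.isRegular_subscheme_iff 𝔟).mp hreg e he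
    exact (idealOrder_le_one_iff_exists 𝔟 e).mpr
      ⟨b, hb ▸ Ideal.mem_span_singleton_self b, not_mem_sq_of_isRegularLocalRing_quotient hbm hb0 hq⟩
  · rw [(idealOrder_eq_zero_iff_not_mem_support 𝔟 e).mpr he]
    exact zero_le_one

/-- **On an INTEGRAL regular locally Noetherian scheme**: a non-zero locally principal ideal sheaf whose zero scheme is
regular has order `≤ 1` everywhere (non-zero stalks by `stalkIdeal_ne_bot_of_ne_bot`). This is the producer-side reading
of TargetsF4's `hord` / `hreg` hypotheses («`V₊(P₀) ⊂ ℙ^m` regular»). [cite: Matsumura1987, Thm. 14.2] -/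
theorem idealOrder_le_one_of_isRegular_subscheme_of_ne_bot {E : Scheme.{u}} [IsIntegral E] [IsLocallyNoetherian E]
    (hE : Scheme.IsRegular E) {𝔟 : E.IdealSheafData} (h0 : 𝔟 ≠ ⊥) (hlp : IsLocallyPrincipal 𝔟)
    (hreg : Scheme.IsRegular 𝔟.subscheme) (e : E) : idealOrder 𝔟 e ≤ 1 :=
  idealOrder_le_one_of_isRegular_subscheme hE hlp (stalkIdeal_ne_bot_of_ne_bot h0) hreg e

/-! ## §3 The equivalence -/

/-- **Regular zero scheme ⇔ order `≤ 1` everywhere** for a locally principal ideal sheaf with non-zero stalks on a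
regular locally Noetherian scheme (the terminal E-side condition of the graded pure engine, in both readings).
[cite: Matsumura1987, Thm. 14.2] [cite: BierstoneGrigorievMilmanWlodarczyk2011, §3.1 p. 6] -/
theorem isRegular_subscheme_iff_forall_idealOrder_le_one {E : Scheme.{u}} [IsLocallyNoetherian E]
    (hE : Scheme.IsRegular E) {𝔟 : E.IdealSheafData} (hlp : IsLocallyPrincipal 𝔟)
    (hnz : ∀ e : E, stalkIdeal 𝔟 e ≠ ⊥) :
    Scheme.IsRegular 𝔟.subscheme ↔ ∀ e : E, idealOrder 𝔟 e ≤ 1 :=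
  ⟨fun hreg => idealOrder_le_one_of_isRegular_subscheme hE hlp hnz hreg,
    isRegular_subscheme_of_isLocallyPrincipal_of_idealOrder_le_one hE hlp⟩

end Summit.ResolutionOfSingularities.ResolutionOfSingularities.Theorems.DepthTargets

end
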